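import Literature.NumberTheory.EllipticCurves.PAdicTwoVariableColemanImageCocycleOfUnitsGalois
import HarnessLib

/-!
# The auxiliary index `a₂` of de Shalit II §4.12 for Galois-indexed families, made ARITHMETIC: if `χ_π(σ̃_{a₂}) = γ^k` then the Weierstrass
# value at `b = n_{a₁} g_{a₁}⁻¹ − 1` of the rescaled factor is `(n_{a₁} g_{a₁}⁻¹)^k − n_{a₂} g_{a₂}⁻¹`, whose constant term is `n_{a₁}^k − n_{a₂}` —
# so **`n_{a₁}^k ≠ n_{a₂}` suffices** (as for the `E_∞`-fixing families of g13 S14)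

De Shalit, *Iwasawa theory of elliptic curves with complex multiplication* (1987), II §4.12 (29)–(33): the pair `(𝔞₁, 𝔞₂)` must make
`(σ_{𝔞₁} − N𝔞₁, σ_{𝔞₂} − N𝔞₂)` "relatively prime".  In `PAdicTwoVariableColemanImageCocycleOfUnitsGalois` (g14 S23) this is the hypothesis
`ha₂ : maxEval_b (t_{χ(σ̃_{a₂})} − C(n_{a₂} g_{a₂}⁻¹)) ≠ 0`.  THIS file discharges it from norms alone when `χ_π(σ̃_{a₂})` is a power of the generator
(everything PROVED, 0 sorry, no definitions, no named facts):

* `maxEval_unitTwistₗ_pow_one_sub_C` — `maxEval_b (t_{γ^k} − C c) = (1 + b)^k − c` (`t_{γ^k} = (1+T)^k`, `maxEval` a ring homomorphism);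
* `constantCoeff_twistValue` — for `b = n₁ g₁⁻¹ − 1`, `c = n₂ g₂⁻¹` with `g_i(0) = 1`: constant term `n₁^k − n₂`;
* ★ `maxEval_twistFactor_ne_zero_of_pow_ne` — **`n₁^k ≠ n₂` (natural numbers, `char F = 0`) ⟹ `ha₂`**;
* ★★ `existsUnique_colemanDeltaCoinvFun_colemanImageCoh_eq_twistMul_of_pow` — S23's `∃! L_ε` with `a₂` given by `χ_π(σ̃_{a₂}) = γ^k`, `n_{a₁}^k ≠ n_{a₂}`.

Cell `bsd-print-cf2`, width seat `bsd-line-cf2c-w7` g14.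

## References
* E. de Shalit, *Iwasawa theory of elliptic curves with complex multiplication* (1987), Ch. II §4.12 (29)–(33). [deShalit1987]
* L. C. Washington, *Introduction to Cyclotomic Fields*, 2nd ed. (1997), §7.1 Prop. 7.2. [Washington1997]
-/

noncomputable section

namespace Literature.NumberTheory.EllipticCurves

open ValuativeRel IsLocalRing Field
open Literature.NumberTheory.GaloisRepresentations Literature.NumberTheory.GaloisRepresentations.IsNonarchimedeanLocalField
  Literature.NumberTheory.GaloisRepresentations.LubinTate
open Literature.RingTheory.PowerSeries (maxEval maxEvalHom maxEvalHom_apply maxEval_C maxEval_X)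

variable {F : Type} [Field F] [ValuativeRel F] [TopologicalSpace F] [IsNonarchimedeanLocalField F]

attribute [local instance] ltNormUniformSpace ltNormIsUniformAddGroup rk1 nF nE fintypeResidueField
attribute [local instance] RelNormCoherentUnits.instCommMonoid
attribute [local instance] isAdicComplete_maximalIdeal_powerSeries_integer

/-! ### §1. The Weierstrass value of the rescaled factor at a power of the generator -/

section Value

variable {π : 𝒪[F]} (hπ : (valuation F).IsUniformizer (π : F)) (hq : residueFieldCard F = 2)
variable {S : Type*} [CommRing S] (ι : LTCoeff F →+* S) [IsAdicComplete (Ideal.span {ι (LTCoeff.of F π)}) S]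
variable (u : (LTCoeff F)ˣ) (hu : LTCoeff.of F π = residueFieldCard F * u) (γ : 𝒪[F]ˣ)
variable (hreg : ∀ s : S, ι (LTCoeff.of F π) * s = 0 → s = 0) (w : 𝒪[F]ˣ) (hγ : (γ : 𝒪[F]) = 1 + π ^ 2 * w)
variable (ε : PowerSeries S)
variable [IsLocalRing S] [IsAdicComplete (IsLocalRing.maximalIdeal S) S]

/-- **`maxEval_b (t_{γ^k} − C c) = (1 + b)^k − c`.** [cite: deShalit1987, Ch. II §4.12 (29)] [cite: Washington1997, §7.1 Prop. 7.2] -/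
theorem maxEval_unitTwistₗ_pow_one_sub_C {b : S} (hb : b ∈ IsLocalRing.maximalIdeal S) (k : ℕ) (c : S) :
    maxEval hb (colemanDeltaCoinvFun hπ hq ι u hu γ hreg w hγ ε
        (unitTwistₗ hπ hq ι u hu γ (γ ^ k) (TActModule.ofPS _ _ 1)) - PowerSeries.C c) = (1 + b) ^ k - c := by
  rw [colemanDeltaCoinvFun_unitTwistₗ_pow_one, ← maxEvalHom_apply, map_sub, map_pow, map_add, map_one, maxEvalHom_apply, maxEvalHom_apply,
    maxEval_X, maxEval_C]

end Value

/-! ### §2. Over `𝒪_F⟦X⟧`: the constant term decides -/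

section Integer

variable {π : 𝒪[F]} (hπ : (valuation F).IsUniformizer (π : F))

omit [TopologicalSpace F] [IsNonarchimedeanLocalField F] in
/-- **Constant term of the Weierstrass value**: for units `g₁, g₂` of `𝒪_F⟦X⟧` with `g_i(0) = 1`,
`((1 + (n₁ g₁⁻¹ − 1))^k − n₂ g₂⁻¹)(0) = n₁^k − n₂`. [cite: deShalit1987, Ch. II §4.12 (29)] -/
theorem constantCoeff_twistValue (n₁ n₂ k : ℕ) (g₁ g₂ : (PowerSeries 𝒪[F])ˣ)
    (hg₁ : PowerSeries.constantCoeff (g₁ : PowerSeries 𝒪[F]) = 1) (hg₂ : PowerSeries.constantCoeff (g₂ : PowerSeries 𝒪[F]) = 1) :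
    PowerSeries.constantCoeff ((1 + (((n₁ : ℕ) : PowerSeries 𝒪[F]) * ((g₁⁻¹ : (PowerSeries 𝒪[F])ˣ) : PowerSeries 𝒪[F]) - 1)) ^ k -
        ((n₂ : ℕ) : PowerSeries 𝒪[F]) * ((g₂⁻¹ : (PowerSeries 𝒪[F])ˣ) : PowerSeries 𝒪[F])) =
      (n₁ : 𝒪[F]) ^ k - n₂ := by
  have hinv : ∀ g : (PowerSeries 𝒪[F])ˣ, PowerSeries.constantCoeff (g : PowerSeries 𝒪[F]) = 1 →
      PowerSeries.constantCoeff ((g⁻¹ : (PowerSeries 𝒪[F])ˣ) : PowerSeries 𝒪[F]) = 1 := fun g hg => by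
    have h := congrArg PowerSeries.constantCoeff g.inv_mul
    rw [map_mul, hg, mul_one, map_one] at h
    exact h
  simp only [map_sub, map_pow, map_mul, map_natCast, hinv g₁ hg₁, hinv g₂ hg₂, mul_one, add_sub_cancel]

variable [IsAdicComplete (Ideal.span {intBase F (LTCoeff.of F π)}) (PowerSeries 𝒪[F])]
variable (hq : residueFieldCard F = 2) (u : (LTCoeff F)ˣ) (hu : LTCoeff.of F π = residueFieldCard F * u) (γ w : 𝒪[F]ˣ)
  (hγ : (γ : 𝒪[F]) = 1 + π ^ 2 * w) (ε : PowerSeries (PowerSeries 𝒪[F]))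

include hπ in
/-- ★ **The auxiliary index from norms**: if `v₂ = γ^k` and `n₁^k ≠ n₂` (naturals; `char F = 0`), then the Weierstrass value at `b = n₁ g₁⁻¹ − 1` of
`t_{v₂} − C(n₂ g₂⁻¹)` is non-zero (its constant term is `n₁^k − n₂ ≠ 0`). [cite: deShalit1987, Ch. II §4.12 (29)–(33)] -/
theorem maxEval_twistFactor_ne_zero_of_pow_ne [CharZero F] {n₁ n₂ k : ℕ} (g₁ g₂ : (PowerSeries 𝒪[F])ˣ)
    (hg₁ : PowerSeries.constantCoeff (g₁ : PowerSeries 𝒪[F]) = 1) (hg₂ : PowerSeries.constantCoeff (g₂ : PowerSeries 𝒪[F]) = 1)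
    (hb : ((n₁ : ℕ) : PowerSeries 𝒪[F]) * ((g₁⁻¹ : (PowerSeries 𝒪[F])ˣ) : PowerSeries 𝒪[F]) - 1 ∈ maximalIdeal (PowerSeries 𝒪[F]))
    {v₂ : 𝒪[F]ˣ} (hv₂ : v₂ = γ ^ k) (hne : n₁ ^ k ≠ n₂) :
    maxEval hb (colemanDeltaCoinvFun hπ hq (intBase F) u hu γ (eq_zero_of_C_pi_mul_eq_zero_integer hπ) w hγ ε
        (unitTwistₗ hπ hq (intBase F) u hu γ v₂ (TActModule.ofPS _ _ 1)) -
      PowerSeries.C (((n₂ : ℕ) : PowerSeries 𝒪[F]) * ((g₂⁻¹ : (PowerSeries 𝒪[F])ˣ) : PowerSeries 𝒪[F]))) ≠ 0 := by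
  rw [hv₂, maxEval_unitTwistₗ_pow_one_sub_C]
  intro h
  have h0 := congrArg PowerSeries.constantCoeff h
  rw [constantCoeff_twistValue n₁ n₂ k g₁ g₂ hg₁ hg₂, map_zero, sub_eq_zero] at h0
  apply hne
  have h' := congrArg (fun x : 𝒪[F] => (x : F)) h0
  push_cast at h'
  exact_mod_cast h'

end Integer

/-! ### §3. S23's `∃! L_ε` with the arithmetic auxiliary index -/

section Cyclic

variable {p : ℕ} [hp : Fact p.Prime] {d : ℕ} (hd : d.Coprime p)
variable {π : 𝒪[F]} (hπ : (valuation F).IsUniformizer (π : F))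
variable (E : ℕ → IntermediateField F (AlgebraicClosure F)) [∀ m, FiniteDimensional F (E m)] [∀ m, Normal F (E m)]
  [∀ m, IsGalois F (E m)] (hmono : Monotone E) (hE : ∀ m, E m ≤ maxUnramified F) (hdeg : ∀ m, Module.finrank F (E m) = d * p ^ m)
  {σ₀ : absoluteGaloisGroup F} (hσ₀ : IsAbsArithFrob σ₀) (hq : residueFieldCard F = 2)
variable (u : (LTCoeff F)ˣ) (hu : LTCoeff.of F π = residueFieldCard F * u) (γ : 𝒪[F]ˣ)
variable [IsAdicComplete (Ideal.span {intBase F (LTCoeff.of F π)}) (PowerSeries 𝒪[F])]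
variable (w : 𝒪[F]ˣ) (hγ : (γ : 𝒪[F]) = 1 + π ^ 2 * w) (ε : PowerSeries (PowerSeries 𝒪[F])) (hε : ε * ε = 1)
variable [NeZero d] [IsAdicComplete (Ideal.span {(p : 𝒪[F])}) 𝒪[F]]
variable {θ : ∀ m, unitBall (E m)} (hθ : ∀ m, IsIntegralNormalGen (E m) (θ m))
  (hcoh : ∀ m, unitBallTrace (hmono (Nat.le_succ m)) (θ (m + 1)) = θ m)
variable [Unique (ZMod d)] [CharZero F]

include hdeg hε in
/-- ★★ **De Shalit II §4.12, two-variable, Galois-indexed, ARITHMETIC auxiliary index**: as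
`existsUnique_colemanDeltaCoinvFun_colemanImageCoh_eq_twistMul`, with `a₂` specified by `χ_π(σ̃_{a₂}) = γ^k` and `n_{a₁}^k ≠ n_{a₂}`.
[cite: deShalit1987, Ch. II §4.12 (29)–(33), §4.14 Step 1] -/
theorem existsUnique_colemanDeltaCoinvFun_colemanImageCoh_eq_twistMul_of_pow {I : Type*} (β : I → coherentFamilies hπ E hmono)
    (σ : I → absoluteGaloisGroup F) (g : I → (PowerSeries 𝒪[F])ˣ) (s : I → ZMod d)
    (hg : ∀ i m, ∃ a : ℕ, (∀ x : E m, σ i • (x : AlgebraicClosure F) = (σ₀ ^ a) • (x : AlgebraicClosure F)) ∧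
      ((1 + PowerSeries.X : PowerSeries 𝒪[F]) ^ p ^ m - 1) ∣ (g i : PowerSeries 𝒪[F]) - (1 + PowerSeries.X) ^ a ∧ (a : ZMod d) = s i)
    (n : I → ℕ)
    (hrel : ∀ (a c : I) (m : ℕ), ((β a).1 m).galAct (σ c) * (β c).1 m ^ n a = ((β c).1 m).galAct (σ a) * (β a).1 m ^ n c)
    (a₁ a₂ : I) (hv₁ : lubinTateChar hπ (σ a₁) = γ) (hn₁ : (π : 𝒪[F]) ∣ (n a₁ : 𝒪[F]) - 1)
    {k : ℕ} (hv₂ : lubinTateChar hπ (σ a₂) = γ ^ k) (hne : n a₁ ^ k ≠ n a₂) (j : ZMod d) :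
    ∃! L : PowerSeries (PowerSeries 𝒪[F]), ∀ c : I,
      colemanDeltaCoinvFun hπ hq (intBase F) u hu γ (eq_zero_of_C_pi_mul_eq_zero_integer hπ) w hγ ε
          (colemanImageCoh hd hπ E hmono hE hdeg hσ₀ hq u hu γ hθ hcoh (β c) j) =
        (colemanDeltaCoinvFun hπ hq (intBase F) u hu γ (eq_zero_of_C_pi_mul_eq_zero_integer hπ) w hγ ε
            (unitTwistₗ hπ hq (intBase F) u hu γ (lubinTateChar hπ (σ c)) (TActModule.ofPS _ _ 1)) *
            PowerSeries.C (g c : PowerSeries 𝒪[F]) - PowerSeries.C ((n c : ℕ) : PowerSeries 𝒪[F])) * L :=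
  existsUnique_colemanDeltaCoinvFun_colemanImageCoh_eq_twistMul hd hπ E hmono hE hdeg hσ₀ hq u hu γ w hγ ε hε hθ hcoh β σ g s hg n hrel a₁ a₂
    hv₁ hn₁ (maxEval_twistFactor_ne_zero_of_pow_ne hπ hq u hu γ w hγ ε (g a₁) (g a₂) (constantCoeff_eq_one_of_amice E (p := p) (hg a₁))
      (constantCoeff_eq_one_of_amice E (p := p) (hg a₂)) _ hv₂ hne) j

end Cyclic

end Literature.NumberTheory.EllipticCurves
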